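/-
Copyright (c) 2026. All rights reserved.
Released under Apache 2.0 license as described in the file LICENSE.
Authors: abc-iut cell, fact-proving seat abc-iut-f-102 (block F, tranche 102).
-/
import Literature.AnabelianGeometry.AbsoluteAnabelian.LogFrobeniusShiftActionIotaIso
import Literature.AnabelianGeometry.AbsoluteAnabelian.LogFrobeniusTwistProofs
import HarnessLib

/-!
# [AbsTopIII] Corollary 5.5 (i)/(iii)/(v) in ONE family of homotopies: ALSO the `ι⊞_{v,ε}` of the arrow leaving the post-log vertex becomes an isomorphism over `ℰ•` (sequel to `LogFrobeniusShiftActionIotaIso.lean`; FACT-LIST rows F-0157 / F-0159)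

S. Mochizuki, *Topics in absolute anabelian geometry III: global reconstruction algorithms*,
J. Math. Sci. Univ. Tokyo 22 (2015) 939–1156 [MochizukiAbsTopIII2015]; locators `p.N` = pages of the
author's manuscript (`paper:url-5493eb38cbb7`): Def 3.5 (ii), (iii) pp. 75–76, Def 5.4 (iii), (v), (vii) pp. 126–128 (the
post-log vertex `k~` and the arrow `k~ → k~` resp. `k~ ↪ (k̄^×)^pf` leaving it; `Λ_ν = log` at the post-log vertex),
Cor 5.5 p. 130 ("we identify the functors associated to the space-link and post-log vertices"), (iii) p. 131, (v) p. 132.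

PROOF-ONLY companion (no `def`, nothing restated).  `LogFrobeniusShiftActionIotaIso.lean` (this seat) proved: inside one
family `K` realising the core `ℰ•` of Cor 5.5 (i) and the observable `S_log⊞_v` of Cor 5.5 (iii) (`RealisesCor55Families K`),
every `ι⊞_{v,ε}` with `ε` between PRE-LOG vertices becomes invertible over `ℰ•`.  Here the remaining arrows — those LEAVING
THE POST-LOG VERTEX (the third clause of `IsLogObservablePlus`: the pair `([λ⊞_{space-link}]∘[id_⋎]∘[log],
[λ⊞_{ν₂}]∘[id_{⋎+1}])` with homotopy `ι⊞_{v,ε}`) — are treated the same way (`isIso_toE_forget_iota_postLog_of_realisesCor55Families`),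
so that **every `ι⊞_{v,ε}`, at every arrow of `Γ⃗^⋉_v`, is invertible over `ℰ•`** under `RealisesCor55Families K` (F-0159) or
`Cor55ShiftAction` (F-0157): `isIso_toE_forget_iota_of_realisesCor55Families'`, `isIso_toE_forget_iota_of_cor55ShiftAction'`
(the target of an admissible arrow is never the post-log vertex: abc-iut-w6-d030's `LogEdge.isPostLog_target`).  In print
this holds because the `λ⊞_{v,ν}` lie over `Th•[Z]` (Def 5.4 (iv)); the interface does not record it.  HONEST LABEL: a
necessary condition on TYPED statements; nothing about print is impugned.  Refereed pre-IUT anabelian geometry; nothing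
here bears on [IUTchIII] Cor. 3.12; typed ≠ proved.
-/

set_option autoImplicit false

universe u

open CategoryTheory Quiver

namespace Literature.AnabelianGeometry.AbsoluteAnabelian

/-! ## Bookkeeping (as in the prequel; `private` there) -/

section HEqLemmas

variable {A : Type*} [Category A] {B : Type*} [Category B]

/-- An invertible natural transformation stays invertible along equalities of its source and target functors. [folklore] -/
private theorem isIso_of_heq' {F G F' G' : A ⥤ B} (hF : F = F') (hG : G = G') {α : F ⟶ G} {β : F' ⟶ G'}
    (h : HEq α β) (hα : IsIso α) : IsIso β := by
  subst hF hG
  cases h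
  exact hα

/-- Components along equalities of the source and target functors differ by `eqToHom`s. [folklore] -/
private theorem app_eq_of_heq' {F G F' G' : A ⥤ B} (hF : F = F') (hG : G = G') {α : F ⟶ G} {β : F' ⟶ G'}
    (h : HEq α β) (x : A) :
    β.app x = eqToHom (by rw [hF]) ≫ α.app x ≫ eqToHom (by rw [hG]) := by
  subst hF hG
  cases h
  simp

/-- The middle factor of an invertible composite with invertible outer factors is invertible. [folklore] -/
private theorem isIso_of_isIso_comp₃' {w x y z : B} (f : w ⟶ x) (g : x ⟶ y) (h : y ⟶ z) [IsIso f] [IsIso h]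
    (H : IsIso (f ≫ g ≫ h)) : IsIso g := by
  haveI : IsIso (g ≫ h) := IsIso.of_isIso_comp_left f (g ≫ h)
  exact IsIso.of_isIso_comp_right g h

/-- Transport of isomorphy of `G(α_y)` along an equality of points `y = x`. [folklore] -/
private theorem isIso_map_app_congr' {C : Type*} [Category C] (G : B ⥤ C) {F₁ F₂ : A ⥤ B} (α : F₁ ⟶ F₂) {y x : A}
    (hyx : y = x) (H : IsIso (G.map (α.app y))) : IsIso (G.map (α.app x)) := by
  subst hyx
  exact H

/-- Transport of isomorphy of `G(f)` along an equality of functors `G = G'`. [folklore] -/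
private theorem isIso_map_congr' {C : Type*} [Category C] {G G' : B ⥤ C} (hG : G = G') {x y : B} (f : x ⟶ y)
    (H : IsIso (G.map f)) : IsIso (G'.map f) := by
  subst hG
  exact H

end HEqLemmas

namespace LogFrobeniusSetting

variable {Vmod : Type u} {isArc : Vmod → Bool} (L : LogFrobeniusSetting Vmod isArc)

/-- The homotopies of one family at (propositionally) equal pairs agree. [cite: MochizukiAbsTopIII2015, Definition 3.5 (ii) p.75] -/
private theorem η_heq_of_eq' (K : L.diagram.HomotopyFamily) {a b : DVertex Vmod isArc} {p p' q q' : Path a b}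
    (hp : p = p') (hq : q = q') (h : K.E p q) (h' : K.E p' q') : HEq (K.η h) (K.η h') := by
  subst hp hq
  rfl

/-! ## The arrow leaving the post-log vertex -/

/-- Core side for the post-log pair: the co-verticial pair of paths `𝒳_{⋎+1} → ℰ•` given by
`[toE]∘[forget]∘[λ⊞_{space-link}]∘[id_⋎]∘[log]` and `[toE]∘[forget]∘[λ⊞_{ν₂}]∘[id_{⋎+1}]` is a boundary pair of `K` with
INVERTIBLE homotopy, as soon as `K` contains the core `ℰ•` of `D•_{≤5}` on `D•_{≤4}` (Def 3.5 (iii)).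
[cite: MochizukiAbsTopIII2015, Definition 3.5 (iii) pp. 75–76] -/
theorem exists_isIso_η_corePair_postLog {K : L.diagram.HomotopyFamily}
    (hcore : L.IsCoreOnIn K (DVertex.InFirstRows 4) .e5) (v : Vmod) (n : ℤ) (ν₂ : LogVertex (isArc v))
    (h₂ : ν₂.isPostLog = false) (hsl : (LogVertex.spaceLink (isArc v)).isPostLog = false) :
    ∃ k : K.E
      (((((Path.nil.cons (DEdge.log n : DVertex.row1 (n + 1) ⟶ DVertex.row1 n)).cons
        (DEdge.toCore n : DVertex.row1 n ⟶ DVertex.core)).cons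
        (DEdge.lam v (LogVertex.spaceLink (isArc v)) hsl : DVertex.core ⟶ DVertex.nplus v)).cons
        (DEdge.forget v : DVertex.nplus v ⟶ DVertex.nv v)).cons (DEdge.toE v : DVertex.nv v ⟶ DVertex.e5))
      ((((Path.nil.cons (DEdge.toCore (n + 1) : DVertex.row1 (n + 1) ⟶ DVertex.core)).cons
        (DEdge.lam v ν₂ h₂ : DVertex.core ⟶ DVertex.nplus v)).cons
        (DEdge.forget v : DVertex.nplus v ⟶ DVertex.nv v)).cons (DEdge.toE v : DVertex.nv v ⟶ DVertex.e5)),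
      IsIso (K.η k) := by
  obtain ⟨He, hHe, hc, hcomp⟩ := hcore
  have hr1 : DVertex.InFirstRows (Vmod := Vmod) (isArc := isArc) 4 (.row1 (n + 1)) := ⟨trivial, by simp [DVertex.row]⟩
  have hr0 : DVertex.InFirstRows (Vmod := Vmod) (isArc := isArc) 4 (.row1 n) := ⟨trivial, by simp [DVertex.row]⟩
  have hc4 : DVertex.InFirstRows (Vmod := Vmod) (isArc := isArc) 4 .core := ⟨trivial, by simp [DVertex.row]⟩
  have hnp4 : DVertex.InFirstRows (Vmod := Vmod) (isArc := isArc) 4 (.nplus v) := ⟨trivial, by simp [DVertex.row]⟩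
  have hnv4 : DVertex.InFirstRows (Vmod := Vmod) (isArc := isArc) 4 (.nv v) := ⟨trivial, by simp [DVertex.row]⟩
  let X4 := obsShape (DVertex.InFirstRows (Vmod := Vmod) (isArc := isArc) 4) DVertex.e5
  let tail : (ν : LogVertex (isArc v)) → ν.isPostLog = false → Path (X4.base ⟨.core, hc4⟩) X4.obs := fun ν hν =>
    ((Path.nil.cons (show X4.base ⟨.core, hc4⟩ ⟶ X4.base ⟨.nplus v, hnp4⟩ from DEdge.lam v ν hν)).cons
      (show X4.base ⟨.nplus v, hnp4⟩ ⟶ X4.base ⟨.nv v, hnv4⟩ from DEdge.forget v)).cons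
      (show X4.base ⟨.nv v, hnv4⟩ ⟶ X4.obs from DEdge.toE v)
  let Q₁ : Path (X4.base ⟨.row1 (n + 1), hr1⟩) X4.obs :=
    ((Path.nil.cons (show X4.base ⟨.row1 (n + 1), hr1⟩ ⟶ X4.base ⟨.row1 n, hr0⟩ from DEdge.log n)).cons
      (show X4.base ⟨.row1 n, hr0⟩ ⟶ X4.base ⟨.core, hc4⟩ from DEdge.toCore n)).comp
      (tail (LogVertex.spaceLink (isArc v)) hsl)
  let Q₂ : Path (X4.base ⟨.row1 (n + 1), hr1⟩) X4.obs :=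
    (Path.nil.cons (show X4.base ⟨.row1 (n + 1), hr1⟩ ⟶ X4.base ⟨.core, hc4⟩ from DEdge.toCore (n + 1))).comp
      (tail ν₂ h₂)
  have hQ : He.E Q₁ Q₂ := hc.boundary_all Q₁ Q₂
  have hiso : IsIso (He.η hQ) :=
    DiagramOfCategories.HomotopyFamily.isIso_of_isSymmetric _ He
      (DiagramOfCategories.Observable.IsCore.isSymmetric _ hc) hQ
  obtain ⟨k, hk⟩ := hcomp Q₁ Q₂ hQ
  have hF₁ : ((L.subdiagram (DVertex.InFirstRows 4)).extend (L.obsExt (DVertex.InFirstRows 4) .e5)).pathFunctor Q₁ =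
      L.diagram.pathFunctor ((embExt (DVertex.InFirstRows 4) .e5).mapPath Q₁) := by
    simp only [Q₁, tail, Path.comp_cons, Path.comp_nil, DiagramOfCategories.pathFunctor_cons,
      DiagramOfCategories.pathFunctor_nil, Prefunctor.mapPath_cons, Prefunctor.mapPath_nil]
    rfl
  have hF₂ : ((L.subdiagram (DVertex.InFirstRows 4)).extend (L.obsExt (DVertex.InFirstRows 4) .e5)).pathFunctor Q₂ =
      L.diagram.pathFunctor ((embExt (DVertex.InFirstRows 4) .e5).mapPath Q₂) := by
    simp only [Q₂, tail, Path.comp_cons, Path.comp_nil, DiagramOfCategories.pathFunctor_cons,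
      DiagramOfCategories.pathFunctor_nil, Prefunctor.mapPath_cons, Prefunctor.mapPath_nil]
    rfl
  exact ⟨k, isIso_of_heq' hF₁ hF₂ hk hiso⟩

/-- Observable side for the post-log pair: if `K` contains `S_log⊞_v`, then for the arrow `ε` of `Γ⃗^⋉_v` leaving the
POST-LOG vertex the pair `([λ⊞_{space-link}]∘[id_⋎]∘[log], [λ⊞_{ν₂}]∘[id_{⋎+1}])` is a boundary pair of `K` whose homotopy is
`ι⊞_{v,ε}` componentwise (third clause of `IsLogObservablePlus`; `λ⊞` at the space-link and post-log vertices are identified,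
Cor 5.5 p. 130). [cite: MochizukiAbsTopIII2015, Cor 5.5 (iii) p. 131] -/
theorem exists_η_obsPair_eq_iota_postLog {K : L.diagram.HomotopyFamily} (v : Vmod)
    (hobs : ∃ H : (L.logDiagramPlus v).HomotopyFamily, L.IsLogObservablePlus v H ∧ L.CompatibleIn K H)
    {ν₁ ν₂ : LogVertex (isArc v)} (ε : LogEdge (isArc v) ν₁ ν₂) (h₁ : ν₁.isPostLog = true)
    (h₂ : ν₂.isPostLog = false) (hsl : (LogVertex.spaceLink (isArc v)).isPostLog = false) (n : ℤ) :
    ∃ k : K.E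
      (((Path.nil.cons (DEdge.log n : DVertex.row1 (n + 1) ⟶ DVertex.row1 n)).cons
        (DEdge.toCore n : DVertex.row1 n ⟶ DVertex.core)).cons
        (DEdge.lam v (LogVertex.spaceLink (isArc v)) hsl : DVertex.core ⟶ DVertex.nplus v))
      ((Path.nil.cons (DEdge.toCore (n + 1) : DVertex.row1 (n + 1) ⟶ DVertex.core)).cons
        (DEdge.lam v ν₂ h₂ : DVertex.core ⟶ DVertex.nplus v)),
      ∀ X₀ : L.diagram.obj (DVertex.row1 (n + 1) : DVertex Vmod isArc),
        ∃ (e₁ : (L.diagram.pathFunctor (((Path.nil.cons (DEdge.log n : DVertex.row1 (n + 1) ⟶ DVertex.row1 n)).cons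
              (DEdge.toCore n : DVertex.row1 n ⟶ DVertex.core)).cons
              (DEdge.lam v (LogVertex.spaceLink (isArc v)) hsl : DVertex.core ⟶ DVertex.nplus v))).obj X₀ =
            (frobeniusTwist L.log ν₁.isPostLog ⋙ L.lam v ν₁).obj X₀)
          (e₂ : (L.lam v ν₂).obj X₀ =
            (L.diagram.pathFunctor ((Path.nil.cons (DEdge.toCore (n + 1) : DVertex.row1 (n + 1) ⟶ DVertex.core)).cons
              (DEdge.lam v ν₂ h₂ : DVertex.core ⟶ DVertex.nplus v))).obj X₀),
          (K.η k).app X₀ = eqToHom e₁ ≫ (L.iota v ε).app X₀ ≫ eqToHom e₂ := by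
  obtain ⟨Hv, hHv, hcomp⟩ := hobs
  obtain ⟨hmem, hι⟩ := hHv.2.2 ν₁ ν₂ ε h₁ h₂ hsl n
  obtain ⟨k, hk⟩ := hcomp (postLogDomPath v n hsl) (postLogCodPath v n ν₂ h₂) hmem
  have hF₁ : (L.logDiagramPlus v).pathFunctor (postLogDomPath v n hsl) =
      L.diagram.pathFunctor (((Path.nil.cons (DEdge.log n : DVertex.row1 (n + 1) ⟶ DVertex.row1 n)).cons
        (DEdge.toCore n : DVertex.row1 n ⟶ DVertex.core)).cons
        (DEdge.lam v (LogVertex.spaceLink (isArc v)) hsl : DVertex.core ⟶ DVertex.nplus v)) := by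
    simp only [postLogDomPath, DiagramOfCategories.pathFunctor_cons, DiagramOfCategories.pathFunctor_nil]
    rfl
  have hF₂ : (L.logDiagramPlus v).pathFunctor (postLogCodPath v n ν₂ h₂) =
      L.diagram.pathFunctor ((Path.nil.cons (DEdge.toCore (n + 1) : DVertex.row1 (n + 1) ⟶ DVertex.core)).cons
        (DEdge.lam v ν₂ h₂ : DVertex.core ⟶ DVertex.nplus v)) := by
    simp only [postLogCodPath, DiagramOfCategories.pathFunctor_cons, DiagramOfCategories.pathFunctor_nil]
    rfl
  refine ⟨k, fun X₀ => ?_⟩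
  obtain ⟨hobj, hobj', hη⟩ := hι X₀
  refine ⟨(Functor.congr_obj hF₁ X₀).symm.trans hobj, hobj'.trans (Functor.congr_obj hF₂ X₀), ?_⟩
  refine (app_eq_of_heq' hF₁ hF₂ hk X₀).trans ?_
  simp only [hη, Category.assoc, eqToHom_trans, eqToHom_trans_assoc]
  rfl

/-- **Also the `ι⊞_{v,ε}` of the arrow leaving the POST-LOG vertex becomes invertible over `ℰ•`** inside one family realising
Cor 5.5 (i)/(iii): the `S_log⊞_v`-pair `([λ⊞_{space-link}]∘[id_⋎]∘[log], [λ⊞_{ν₂}]∘[id_{⋎+1}])` (homotopy `ι⊞_{v,ε}`), post-composed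
with `𝒩⊞_v → 𝒩_v → ℰ•`, is a boundary pair of the CORE `ℰ•` (every homotopy invertible).
[cite: MochizukiAbsTopIII2015, Cor 5.5 (iii) p. 131] -/
theorem isIso_toE_forget_iota_postLog_of_realisesCor55Families {K : L.diagram.HomotopyFamily}
    (hK : L.RealisesCor55Families K) (v : Vmod) {ν₁ ν₂ : LogVertex (isArc v)} (ε : LogEdge (isArc v) ν₁ ν₂)
    (h₁ : ν₁.isPostLog = true) (X₀ : L.X) :
    IsIso ((L.toE v).map ((L.forget v).map ((L.iota v ε).app X₀))) := by
  have h₂ : ν₂.isPostLog = false := LogEdge.isPostLog_target ε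
  have hsl : (LogVertex.spaceLink (isArc v)).isPostLog = false := spaceLink_isPostLog _
  obtain ⟨k, hk⟩ := L.exists_isIso_η_corePair_postLog hK.1 v 0 ν₂ h₂ hsl
  obtain ⟨k₁, hk₁⟩ := L.exists_η_obsPair_eq_iota_postLog v (hK.2.2.2 v) ε h₁ h₂ hsl 0
  let r : Path (DVertex.nplus v : DVertex Vmod isArc) DVertex.e5 :=
    (Path.nil.cons (DEdge.forget v : DVertex.nplus v ⟶ DVertex.nv v)).cons (DEdge.toE v : DVertex.nv v ⟶ DVertex.e5)
  have hw := K.η_whisker k₁ Path.nil r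
  have hiso₂ : IsIso (K.η (K.isSaturated.precomp (K.isSaturated.postcomp k₁ r) Path.nil)) :=
    isIso_of_heq' (congrArg L.diagram.pathFunctor (Path.nil_comp _).symm)
      (congrArg L.diagram.pathFunctor (Path.nil_comp _).symm)
      (L.η_heq_of_eq' K (Path.nil_comp _).symm (Path.nil_comp _).symm k _) hk
  rw [hw] at hiso₂
  have hW := isIso_of_isIso_comp₃' _ _ _ hiso₂
  have h3 : IsIso ((L.diagram.pathFunctor r).map ((K.η k₁).app
      ((L.diagram.pathFunctor (Path.nil : Path (DVertex.row1 ((0 : ℤ) + 1) : DVertex Vmod isArc)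
        (.row1 ((0 : ℤ) + 1)))).obj X₀))) := by
    haveI := hW
    exact (inferInstance : IsIso ((Functor.whiskerLeft (L.diagram.pathFunctor Path.nil)
      (Functor.whiskerRight (K.η k₁) (L.diagram.pathFunctor r))).app X₀))
  obtain ⟨e₁, e₂, hY⟩ :=
    hk₁ ((L.diagram.pathFunctor (Path.nil : Path (DVertex.row1 ((0 : ℤ) + 1) : DVertex Vmod isArc)
      (.row1 ((0 : ℤ) + 1)))).obj X₀)
  rw [hY] at h3
  simp only [Functor.map_comp] at h3
  have h4 := isIso_of_isIso_comp₃' _ _ _ h3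
  have hr : L.diagram.pathFunctor r = (𝟭 _ ⋙ L.forget v) ⋙ L.toE v := by
    simp only [r, DiagramOfCategories.pathFunctor_cons, DiagramOfCategories.pathFunctor_nil]
    rfl
  have h0 : (L.diagram.pathFunctor (Path.nil : Path (DVertex.row1 ((0 : ℤ) + 1) : DVertex Vmod isArc)
      (.row1 ((0 : ℤ) + 1)))).obj X₀ = X₀ := by
    rw [DiagramOfCategories.pathFunctor_nil]
    rfl
  exact isIso_map_app_congr' _ (L.iota v ε) h0 (isIso_map_congr' hr _ h4)

/-- **Every `ι⊞_{v,ε}` — at every arrow `ε` of `Γ⃗^⋉_v` — becomes invertible over `ℰ•` inside one family realising Cor 5.5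
(i)/(iii)** (the source of `ε` is either pre-log or the post-log vertex; its target is always pre-log,
`LogEdge.isPostLog_target`). [cite: MochizukiAbsTopIII2015, Cor 5.5 (iii) p. 131] -/
theorem isIso_toE_forget_iota_of_realisesCor55Families' {K : L.diagram.HomotopyFamily}
    (hK : L.RealisesCor55Families K) (v : Vmod) {ν₁ ν₂ : LogVertex (isArc v)} (ε : LogEdge (isArc v) ν₁ ν₂)
    (X₀ : L.X) : IsIso ((L.toE v).map ((L.forget v).map ((L.iota v ε).app X₀))) := by
  rcases Bool.eq_false_or_eq_true ν₁.isPostLog with h₁ | h₁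
  · exact L.isIso_toE_forget_iota_postLog_of_realisesCor55Families hK v ε h₁ X₀
  · exact L.isIso_toE_forget_iota_of_realisesCor55Families hK v ε h₁ (LogEdge.isPostLog_target ε) X₀

/-- The same under the `ℤ`-action clause of Cor 5.5 (v) (F-0157): every `ι⊞_{v,ε}` is invertible over `ℰ•`.
[cite: MochizukiAbsTopIII2015, Cor 5.5 (v) p. 132] -/
theorem isIso_toE_forget_iota_of_cor55ShiftAction' (hL : L.Cor55ShiftAction) (v : Vmod)
    {ν₁ ν₂ : LogVertex (isArc v)} (ε : LogEdge (isArc v) ν₁ ν₂) (X₀ : L.X) :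
    IsIso ((L.toE v).map ((L.forget v).map ((L.iota v ε).app X₀))) := by
  obtain ⟨K, hK, -⟩ := L.cor55ShiftAction_iff.mp hL
  exact L.isIso_toE_forget_iota_of_realisesCor55Families' hK v ε X₀

end LogFrobeniusSetting

end Literature.AnabelianGeometry.AbsoluteAnabelian
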